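import Summits.ResolutionOfSingularities.ResolutionOfSingularities.Theorems.PurityTransfer.Negative.ResidueFunctional

/-!
# `PurityTransfer` (crux stmt-ResolutionOfSingularities-17142, route `WildPurity`) — negative side,
# file 5/5: the binder `R ⊆ O` is LOAD-BEARING (the crux with it deleted is false; this does NOT refute the crux)

Data: `p = 2`, `k = 𝔽₂`, `K = 𝔽₂(x,y)`, `O` = the monomial valuation ring at infinity (file 4/5),
`R = 𝔽₂[x,y] ⊆ K` — finitely generated (`R_fg`), `Frac R = K`, regular hence
`HasResolution (Spec R)` (`hasResolution_R`, via `Scheme.isRegular_Spec` and Mathlib's regularity of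
polynomial rings), but `x ∉ O` (`not_R_le_O`). Since no nonzero polynomial lies in the maximal
ideal of `O`, the centre of `O` on `R` is the generic point, so a discrete valuation ring `W ⊇ R`
with centre inside it would be all of `K` — impossible, a field is not a discrete valuation ring: the crux's divisorial hypothesis is VACUOUS at `(K, O, R)`
(`no_admissible_W`) and holds for every class, in particular for `α = [1, x, y}`, which is not
`O`-integral (file 4/5). Hence `purityTransfer_false_without_le`: the crux's statement with the
single binder `R.toSubring ≤ O.toSubring` deleted (stated inline, otherwise verbatim) is FALSE.

Moral for provers: `R ⊆ O` enters the printed proof exactly once — it puts the centre of `O` on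
`Spec R`, so that the valuative criterion lifts `Spec O` to the regular model; without it the
admissible family of prime divisors can be empty. [folklore]
-/

noncomputable section

-- single-problem summit: the doubled namespace component `ResolutionOfSingularities` is forced
set_option linter.dupNamespace false

open Finset

namespace Summit.ResolutionOfSingularities.ResolutionOfSingularities.Theorems.PurityTransfer.Negative

section FunctionField

open MvPolynomial

/-- `R = 𝔽₂[x, y]` is the subalgebra generated by `x` and `y`. -/
theorem R_eq_adjoin : R = Algebra.adjoin (ZMod 2) (Set.range ![xK, yK]) := by
  rw [Algebra.adjoin_range_eq_range_aeval, R]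
  congr 1
  refine MvPolynomial.algHom_ext fun i => ?_
  fin_cases i <;> simp [xK, yK]

/-- `R` is finitely generated. -/
theorem R_fg : R.FG := by
  rw [R_eq_adjoin]
  refine ⟨(Finset.univ : Finset (Fin 2)).image ![xK, yK], ?_⟩
  congr 1
  ext z
  simp

/-- `x ∈ R`. -/
theorem x_mem_R : xK ∈ R := algebraMap_mem_R _

/-- `R ⊄ O`: the hypothesis deleted in `purityTransfer_false_without_le` really fails for this data. -/
theorem not_R_le_O : ¬ R.toSubring ≤ O.toSubring := fun h => xK_notMem_O (h x_mem_R)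

/-- `Spec R` is regular, hence has a resolution (the identity). -/
theorem hasResolution_R :
    Literature.AlgebraicGeometry.Resolution.Scheme.HasResolution
      (AlgebraicGeometry.Spec (CommRingCat.of R)) :=
  (Literature.AlgebraicGeometry.Resolution.Scheme.isRegular_Spec (CommRingCat.of R)).hasResolution

/-- `K = 𝔽₂(x, y)` is finitely generated over `𝔽₂`. -/
theorem top_fg : (⊤ : IntermediateField (ZMod 2) K).FG := by
  refine ⟨{xK, yK}, ?_⟩
  rw [eq_top_iff]
  intro z _
  obtain ⟨P, Q, -, rfl⟩ := IsFractionRing.div_surjective (A := Poly) z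
  have hsub : R ≤ (IntermediateField.adjoin (ZMod 2) (↑({xK, yK} : Finset K) : Set K)).toSubalgebra := by
    rw [R_eq_adjoin]
    refine le_trans (Algebra.adjoin_mono ?_) (IntermediateField.algebra_adjoin_le_adjoin _ _)
    rintro _ ⟨i, rfl⟩
    fin_cases i <;> simp
  exact div_mem (hsub (algebraMap_mem_R P)) (hsub (algebraMap_mem_R Q))

/-- **vacuity**: no discrete valuation ring `W ⊇ R` has centre on `R = 𝔽₂[x,y]` inside the
centre of `O` (which is the zero ideal): the divisorial hypothesis of the crux is EMPTY at
`(K, O, R)`. -/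
theorem no_admissible_W (W : ValuationSubring K) (hdvr : IsDiscreteValuationRing W)
    (hRW : R.toSubring ≤ W.toSubring)
    (hcen : ∀ x : K, x ∈ R → x ∈ W.nonunits → x ∈ O.nonunits) : False := by
  -- (1) no nonzero element of `R` lies in the maximal ideal of `W`
  have hzero : ∀ x : K, x ∈ R → x ∈ W.nonunits → x = 0 := by
    intro x hx hxW
    by_contra hne
    obtain ⟨P, rfl⟩ := (mem_R_iff x).mp hx
    have hP : P ≠ 0 := by rintro rfl; exact hne (map_zero _)
    exact algebraMap_notMem_nonunits hP (hcen _ hx hxW)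
  -- (2) hence every element `r / s` of `K = Frac R` lies in `W`: `W = ⊤`
  have hW : W = ⊤ := by
    refine top_unique fun x _ => ?_
    obtain ⟨r, s, hs, rfl⟩ := IsFractionRing.div_surjective (A := R) x
    have hs0 : ((s : R) : K) ≠ 0 := by
      intro h0
      exact nonZeroDivisors.ne_zero hs (Subtype.ext (by simpa using h0))
    have hsW : ((s : R) : K) ∉ W.nonunits := fun hh => hs0 (hzero _ s.2 hh)
    have hsunit : W.valuation ((s : R) : K) = 1 := by
      have h1 : W.valuation ((s : R) : K) ≤ 1 := (W.valuation_le_one_iff _).mpr (hRW s.2)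
      have h2 : ¬ W.valuation ((s : R) : K) < 1 := fun hlt => hsW ((W.mem_nonunits_iff).mpr hlt)
      exact le_antisymm h1 (not_lt.mp h2)
    show algebraMap R K r / algebraMap R K s ∈ W
    rw [← W.valuation_le_one_iff, map_div₀]
    change W.valuation (r : K) / W.valuation ((s : R) : K) ≤ 1
    rw [hsunit, div_one]
    exact (W.valuation_le_one_iff _).mpr (hRW r.2)
  -- (3) but the trivial valuation ring is a field, not a discrete valuation ring
  subst hW
  apply IsDiscreteValuationRing.not_isField (⊤ : ValuationSubring K)
  exact
    { exists_pair_ne := ⟨0, 1, zero_ne_one⟩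
      mul_comm := mul_comm
      mul_inv_cancel := fun {a} ha =>
        ⟨⟨(a : K)⁻¹, ValuationSubring.mem_top _⟩,
          Subtype.ext (mul_inv_cancel₀ fun h0 => ha (Subtype.ext h0))⟩ }

/-- **`R ⊆ O` is load-bearing**: with it deleted the crux is FALSE. Witness `p = 2`, `k = 𝔽₂`,
`K = 𝔽₂(x,y)`, `O` = the monomial valuation ring at infinity (`y ≫ x`), `R = 𝔽₂[x,y]` (regular, so
`Spec R` has a resolution; `Frac R = K`; but `x ∉ O`): the centre of `O` on `R` is `0`, so NO
discrete valuation ring `W ⊇ R` has centre inside it (such a `W` would be all of `K`) and the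
divisorial hypothesis holds vacuously for EVERY class, while `α = [1, x, y}` is not `O`-integral
(its residue `Φ α = 1`). -/
theorem purityTransfer_false_without_le : ¬ (∀ p : ℕ, p.Prime → ∀ (k K : Type) [Field k] [CharP k p] [PerfectField k] [Field K] [Algebra k K], (⊤ : IntermediateField k K).FG → ∀ O : ValuationSubring K, (∀ c : k, algebraMap k K c ∈ O) → ∀ R : Subalgebra k K, R.FG → IsFractionRing R K → Literature.AlgebraicGeometry.Resolution.Scheme.HasResolution (AlgebraicGeometry.Spec (CommRingCat.of R)) → (let G := FreeAbelianGroup (K × Kˣ × Kˣ); let N : AddSubgroup G := AddSubgroup.closure { x | (∃ (a a' : K) (b c : Kˣ), x = .of (a + a', b, c) - .of (a, b, c) - .of (a', b, c)) ∨ (∃ (a : K) (b b' c : Kˣ), x = .of (a, b * b', c) - .of (a, b, c) - .of (a, b', c)) ∨ (∃ (a : K) (b c c' : Kˣ), x = .of (a, b, c * c') - .of (a, b, c) - .of (a, b, c')) ∨ (∃ (a : K) (b : Kˣ), x = .of (a, b, b)) ∨ (∃ (b c : Kˣ), x = .of ((b : K), b, c)) ∨ (∃ (b c : Kˣ), x =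 .of ((c : K), b, c)) ∨ (∃ (a : K) (b c : Kˣ), x = .of (a ^ p - a, b, c)) }; let Unr : Subring K → AddSubgroup (G ⧸ N) := fun T => AddSubgroup.closure { y | ∃ (a : K) (b c : Kˣ), a ∈ T ∧ (b : K) ∈ T ∧ ((b⁻¹ : Kˣ) : K) ∈ T ∧ (c : K) ∈ T ∧ ((c⁻¹ : Kˣ) : K) ∈ T ∧ y = ((FreeAbelianGroup.of (a, b, c) : G) : G ⧸ N) }; ∀ α : G ⧸ N, (∀ W : ValuationSubring K, (∀ c : k, algebraMap k K c ∈ W) → IsDiscreteValuationRing W → (∃ B : Subalgebra k K, B.FG ∧ B.toSubring ≤ W.toSubring ∧ ∀ x : K, x ∈ W → ∃ b s : K, b ∈ B ∧ s ∈ B ∧ s ∉ W.nonunits ∧ x * s = b) → R.toSubring ≤ W.toSubring → (∀ x : K, x ∈ R → x ∈ W.nonunits → x ∈ O.nonunits) → α ∈ Unr W.toSubring) → α ∈ Unr O.toSubring)) := by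
  intro h
  have key := h 2 Nat.prime_two (ZMod 2) K top_fg O algebraMap_mem_O R R_fg isFractionRing_R
    hasResolution_R
  have := key ((FreeAbelianGroup.of ((1 : K), xU, yU) : FreeAbelianGroup (K × Kˣ × Kˣ)) :
      FreeAbelianGroup (K × Kˣ × Kˣ) ⧸ katoRel 2 K) ?_
  · exact sym_one_x_y_notMem_unr_O this
  · intro W _ hdvr _ hRW hcen
    exact (no_admissible_W W hdvr hRW hcen).elim

end FunctionField

end Summit.ResolutionOfSingularities.ResolutionOfSingularities.Theorems.PurityTransfer.Negative
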